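import Summits.HodgeConjecture.HodgeConjecture.Cruxes.BlochSeedDiscOne.DepthBoundA4

/-!
line stmt-HodgeConjecture-18881 Cruxes/BlochSeedDiscOne/Lines/birth.lean 814a6a70c14e831a stub_rung_pad4_seedAt

# LFLadderB136 — the block-map predicates HALL-AT-T ∕ COVER-NINE ∕ SURPLUS-EIGHT on `DepthBoundA4.Design`, evaluated in the kernel
on the rotated-pair family `D_j` (B136 = `D_8`): typed companion of `B136-LF-LADDER-monad3-g15.md` (hsemireg-monad-3 g15, 2026-08-30).

STATUS ∕ SCOPE.  Letter-model bookkeeping only: three NECESSARY conditions for the display `0 → ⊕_P L_x^{m_x} —φ→ ⊕_N L_y^{m_y} → 𝓔 → 0`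
of a two-term design to have `φ` injective at every point (so that `𝓔 = coker φ` is locally free), written as instance-free predicates with
`Bool` mirrors, and their values on `D_8`, `D_60`, `D_67`, `D_68`, `D_71` by `decide +kernel`.  A letter design ≠ a display ≠ a sheaf ≠ a SEED;
NOTHING here is proved toward HC ∕ HC_CM ∕ HC_AV ∕ №4 ∕ 26512 ∕ 18881 ∕ H2, and nothing here re-decides `Nonex 14 199 8` (refuted as typed in
`RotatedPairB136.lean`).  The geometric content of the three conditions (why they are necessary) is NOT formalised here — it is the cited
pen argument of the memo: HALL-AT-T = term rank (a pointwise-injective block map restricted to the columns `T` lands in the rows `Γ(T)`);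
COVER-NINE = Fulton, Intersection Theory, Ex. 14.4.2 (m columns out of one cell need live N-mass ≥ m + dim X, dim X = 8, because the top
Chern class of the ample difference bundles is non-zero); SURPLUS-EIGHT = Fulton Ex. 14.4.13(b) (Hom(P[T], N[Γ(T)]) ample and
dim X − (surplus + 1) ≥ 0 ⇒ the degeneracy locus is non-empty for EVERY map), valid when every arrow out of `T` is four-ample — which holds
for every arrow of these designs ((A4♯), `RotatedPairB136.sharpTab`).

THE FAMILY (§2).  `D_j := (j·hub⁴ + Σ_{k<4} 16·(ρᵏt)⁴, Σ_{k<4} (ρᵏu′)^{⊠4})` on the height-9 alphabet, `hub = (9;0,0)`, `t = (2;−4,3)`,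
`u′ = (0;4,5) + (4;4,1)` — for `j = 8` these are LITERALLY the lists `DN`, `DP` of `RotatedPairB136.lean` §3 (not imported: that module had no
build on the farm when this file was written); copies `128 + j`, rank `j`.  `S60` (§3) = the 60 P-cells with no four-ample arrow to a t-cell
(their only live N-partner is `hub⁴`).

RESULTS (§4, all `decide +kernel`): `S60.length = 60`; on `D_8`: P-mass of `S60` = 60, live N-mass above `S60` = 8, so `¬ HallAt D_8 S60`
(term-rank deficiency 52 — the audit's row H_Hall, here a seventh code) and `¬ CoverNine D_8` with exactly 60 failing cells; on `D_60`:
`HallAt` holds at `S60` but `¬ SurplusAt D_60 S60`; `¬ SurplusAt D_67 S60`; `SurplusAt D_68 S60`, `CoverNine D_68`, copies 196, rank 68;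
`SurplusAt D_71 S60`, copies 199, rank 71.  (A1) ∕ μ for `D_j`, `j ≠ 8`, are NOT certified here (pen: the class tensor is affine in the hub
multiplicity and hub⁴ feeds only e-free words; machine-checked in ℤ[i] by the memo's `a1check.py` for j = 8, 60, 68, 71).

No `sorry`, no `axiom`, no `instance`, no notation, no `native_decide`, no unsafe options.  Words by director-hodge only.
-/

set_option linter.dupNamespace false
set_option autoImplicit false
set_option maxRecDepth 8192
set_option maxHeartbeats 4000000

namespace Summit.HodgeConjecture.HodgeConjecture.Cruxes.BlochSeedDiscOne.LFLadderB136

open Summit.HodgeConjecture.HodgeConjecture.Cruxes.BlochSeedDiscOne.DepthBoundA4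

/-! ## §1 Boolean checkers and bridges (the `RotatedPairB136.lean` §2 idiom, instance-free) -/

/-- every element passes (tail form). -/
def allB {α : Type} : List α → (α → Bool) → Bool
  | [], _ => true
  | x :: l, f => match f x with | true => allB l f | false => false

theorem allB_iff {α : Type} (l : List α) (f : α → Bool) : allB l f = true ↔ ∀ x ∈ l, f x = true := by
  induction l with
  | nil => simp [allB]
  | cons x l ih =>
    simp only [allB, List.mem_cons, forall_eq_or_imp]
    cases hx : f x <;> simp [ih]

/-- some element passes (tail form). -/
def anyB {α : Type} : List α → (α → Bool) → Bool
  | [], _ => false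
  | x :: l, f => match f x with | true => true | false => anyB l f

theorem anyB_iff {α : Type} (l : List α) (f : α → Bool) : anyB l f = true ↔ ∃ x ∈ l, f x = true := by
  induction l with
  | nil => simp [anyB]
  | cons x l ih =>
    simp only [anyB, List.mem_cons, exists_eq_or_imp]
    cases hx : f x <;> simp [ih]

/-- a cell from four letters. -/
def cellOf (l₀ l₁ l₂ l₃ : Letter) : Cell := fun f =>
  match f with
  | ⟨0, _⟩ => l₀
  | ⟨1, _⟩ => l₁
  | ⟨2, _⟩ => l₂
  | ⟨_, _⟩ => l₃

/-- level 3 of the product block. -/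
def blk3 (u : List (Letter × ℕ)) (a b c : Letter) (m : ℕ) : List (Cell × ℕ) := u.map fun e => (cellOf a b c e.1, m * e.2)
/-- level 2. -/
def blk2 (u : List (Letter × ℕ)) (a b : Letter) (m : ℕ) : List (Cell × ℕ) := u.flatMap fun e => blk3 u a b e.1 (m * e.2)
/-- level 1. -/
def blk1 (u : List (Letter × ℕ)) (a : Letter) (m : ℕ) : List (Cell × ℕ) := u.flatMap fun e => blk2 u a e.1 (m * e.2)
/-- the product block `u^{⊠4}`. -/
def prod4 (u : List (Letter × ℕ)) : List (Cell × ℕ) := u.flatMap fun e => blk1 u e.1 e.2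

/-- raw four-ample test on one factor (squares as products). -/
def ampleB (ℓ ℓ' : Letter) : Bool :=
  decide (ℓ.a < ℓ'.a) && decide ((ℓ'.x - ℓ.x) * (ℓ'.x - ℓ.x) + (ℓ'.y - ℓ.y) * (ℓ'.y - ℓ.y) < (ℓ'.a - ℓ.a) * (ℓ'.a - ℓ.a))

theorem ampleAbove_of_B {ℓ ℓ' : Letter} (h : ampleB ℓ ℓ' = true) : AmpleAbove ℓ ℓ' := by
  simp only [ampleB, Bool.and_eq_true, decide_eq_true_eq] at h
  refine ⟨h.1, ?_⟩
  simp only [pow_two]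
  exact h.2

theorem B_of_ampleAbove {ℓ ℓ' : Letter} (h : AmpleAbove ℓ ℓ') : ampleB ℓ ℓ' = true := by
  obtain ⟨h1, h2⟩ := h
  simp only [ampleB, Bool.and_eq_true, decide_eq_true_eq]
  refine ⟨h1, ?_⟩
  simpa only [pow_two] using h2

/-- raw LIVE test (four-ample on all four factors). -/
def liveB (x y : Cell) : Bool := ampleB (x 0) (y 0) && ampleB (x 1) (y 1) && ampleB (x 2) (y 2) && ampleB (x 3) (y 3)

theorem live_of_B {x y : Cell} (h : liveB x y = true) : Live x y := by
  simp only [liveB, Bool.and_eq_true] at h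
  obtain ⟨⟨⟨h0, h1⟩, h2⟩, h3⟩ := h
  intro f
  fin_cases f
  · exact ampleAbove_of_B h0
  · exact ampleAbove_of_B h1
  · exact ampleAbove_of_B h2
  · exact ampleAbove_of_B h3

theorem B_of_live {x y : Cell} (h : Live x y) : liveB x y = true := by
  simp only [liveB, Bool.and_eq_true]
  exact ⟨⟨⟨B_of_ampleAbove (h 0), B_of_ampleAbove (h 1)⟩, B_of_ampleAbove (h 2)⟩, B_of_ampleAbove (h 3)⟩

/-- `liveB` IS `Live`. -/
theorem liveB_iff (x y : Cell) : liveB x y = true ↔ Live x y := ⟨live_of_B, B_of_live⟩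

/-- raw cell equality (letters have `DecidableEq`). -/
def cellEqB (x y : Cell) : Bool := decide (x 0 = y 0) && decide (x 1 = y 1) && decide (x 2 = y 2) && decide (x 3 = y 3)

theorem cellEqB_iff (x y : Cell) : cellEqB x y = true ↔ x = y := by
  constructor
  · intro h
    simp only [cellEqB, Bool.and_eq_true, decide_eq_true_eq] at h
    obtain ⟨⟨⟨h0, h1⟩, h2⟩, h3⟩ := h
    funext f
    fin_cases f
    · exact h0
    · exact h1
    · exact h2
    · exact h3
  · rintro rfl
    simp [cellEqB]

/-- raw list membership of a cell. -/
def memB (T : List Cell) (x : Cell) : Bool := anyB T fun y => cellEqB x y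

theorem memB_iff (T : List Cell) (x : Cell) : memB T x = true ↔ x ∈ T := by
  unfold memB
  rw [anyB_iff]
  constructor
  · rintro ⟨y, hy, he⟩
    rw [cellEqB_iff] at he
    exact he ▸ hy
  · intro hx
    exact ⟨x, hx, (cellEqB_iff x x).2 rfl⟩

/-! ## §2 The block-map predicates (instance-free; `Bool` mirrors inside, `Prop` outside) -/

/-- live N-mass above the cell `x`: `Σ m_y` over the N-entries `y` with `x → y` LIVE (four-ample). -/
def massAbove (E : Design) (x : Cell) : ℕ := ((E.N.filter fun ym => liveB x ym.1).map Prod.snd).sum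

/-- P-mass of a cell list `T`: `Σ m_x` over the P-entries whose cell lies in `T`. -/
def massP (E : Design) (T : List Cell) : ℕ := ((E.P.filter fun xm => memB T xm.1).map Prod.snd).sum

/-- live N-mass above a cell list `T` (the neighbourhood `Γ(T)`, multiplicities counted once). -/
def massNabove (E : Design) (T : List Cell) : ℕ := ((E.N.filter fun ym => anyB T fun x => liveB x ym.1).map Prod.snd).sum

/-- **HALL AT `T`** (term rank on the columns `T`): P-mass of `T` ≤ live N-mass above `T`.  Necessary for a pointwise-injective block map.
(The audit's H_Hall ∕ H_TR is `∀ T`; this file evaluates single `T`.) -/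
def HallAt (E : Design) (T : List Cell) : Prop := massP E T ≤ massNabove E T

/-- **COVER-NINE** (Fulton Ex. 14.4.2 on the 8-fold): every P-entry of multiplicity `m > 0` has live N-mass `≥ m + 8` above its cell. -/
def CoverNine (E : Design) : Prop := ∀ xm ∈ E.P, 0 < xm.2 → xm.2 + 8 ≤ massAbove E xm.1

/-- **SURPLUS-EIGHT AT `T`** (Fulton Ex. 14.4.13(b), all arrows out of `T` four-ample): P-mass of `T` + 8 ≤ live N-mass above `T`. -/
def SurplusAt (E : Design) (T : List Cell) : Prop := massP E T + 8 ≤ massNabove E T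

theorem surplusAt_hallAt {E : Design} {T : List Cell} (h : SurplusAt E T) : HallAt E T :=
  le_trans (Nat.le_add_right _ _) h

/-! ## §3 The rotated-pair family `D_j` (hub multiplicity `j`; `D_8` = B136 = `RotatedPairB136.D` verbatim) and the violator `S60` -/

/-- the hub cell `(9;0,0)⁴`. -/
def hub4 : Cell := cellOf ⟨9, 0, 0⟩ ⟨9, 0, 0⟩ ⟨9, 0, 0⟩ ⟨9, 0, 0⟩

/-- `ρᵏu = 2·ρᵏt`, `t = (2;−4,3)`, `ρ(a;x,y) = (a;−y,x)`. -/
def uN0 : List (Letter × ℕ) := [(⟨2, -4, 3⟩, 2)]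
def uN1 : List (Letter × ℕ) := [(⟨2, -3, -4⟩, 2)]
def uN2 : List (Letter × ℕ) := [(⟨2, 4, -3⟩, 2)]
def uN3 : List (Letter × ℕ) := [(⟨2, 3, 4⟩, 2)]
/-- `ρᵏu′`, `u′ = (0;4,5) + (4;4,1)`. -/
def vP0 : List (Letter × ℕ) := [(⟨0, 4, 5⟩, 1), (⟨4, 4, 1⟩, 1)]
def vP1 : List (Letter × ℕ) := [(⟨0, -5, 4⟩, 1), (⟨4, -1, 4⟩, 1)]
def vP2 : List (Letter × ℕ) := [(⟨0, -4, -5⟩, 1), (⟨4, -4, -1⟩, 1)]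
def vP3 : List (Letter × ℕ) := [(⟨0, 5, -4⟩, 1), (⟨4, 1, -4⟩, 1)]

/-- the four t-blocks `Σ_k 16·(ρᵏt)⁴` (N side, without the hub). -/
def DNt : List (Cell × ℕ) := prod4 uN0 ++ prod4 uN1 ++ prod4 uN2 ++ prod4 uN3
/-- N side of `D_j`. -/
def DN (j : ℕ) : List (Cell × ℕ) := (hub4, j) :: DNt
/-- P side (the same for every `j`). -/
def DP : List (Cell × ℕ) := prod4 vP0 ++ prod4 vP1 ++ prod4 vP2 ++ prod4 vP3
/-- the family. -/
def Dj (j : ℕ) : Design := ⟨DN j, DP⟩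

/-- the Hall violator: the P-cells with NO live arrow to any t-cell (their only live N-partner is `hub⁴`). -/
def S60 : List Cell := (DP.map Prod.fst).filter fun x => !(anyB DNt fun yn => liveB x yn.1)

/-! ## §4 Kernel evaluations (`decide +kernel`) -/

theorem S60_length : S60.length = 60 := by decide +kernel
theorem DP_length : DP.length = 64 := by decide +kernel
theorem posP : allB DP (fun cm => decide (0 < cm.2)) = true := by decide +kernel

/-- every P-cell is live below the hub (so every arrow out of `S60` is four-ample and lands in `hub⁴`). -/
theorem liveHub : allB DP (fun cm => liveB cm.1 hub4) = true := by decide +kernel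
/-- no cell of `S60` is live below any t-cell (definition unfolded as a table). -/
theorem S60_blind : allB S60 (fun x => !(anyB DNt fun yn => liveB x yn.1)) = true := by decide +kernel

theorem copies_8 : (Dj 8).copies = 136 := by decide +kernel
theorem rank_8 : (Dj 8).rank = 8 := by decide +kernel
theorem copies_68 : (Dj 68).copies = 196 := by decide +kernel
theorem rank_68 : (Dj 68).rank = 68 := by decide +kernel
theorem copies_71 : (Dj 71).copies = 199 := by decide +kernel
theorem rank_71 : (Dj 71).rank = 71 := by decide +kernel

theorem massP_S60 : massP (Dj 8) S60 = 60 := by decide +kernel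
theorem massN_S60_8 : massNabove (Dj 8) S60 = 8 := by decide +kernel
theorem massN_S60_60 : massNabove (Dj 60) S60 = 60 := by decide +kernel
theorem massN_S60_67 : massNabove (Dj 67) S60 = 67 := by decide +kernel
theorem massN_S60_68 : massNabove (Dj 68) S60 = 68 := by decide +kernel
theorem massN_S60_71 : massNabove (Dj 71) S60 = 71 := by decide +kernel

/-- **H_Hall on B136 (seventh code): term-rank deficiency 52 at `S60`.** -/
theorem not_hallAt_8 : ¬ HallAt (Dj 8) S60 := by
  unfold HallAt; rw [massP_S60, massN_S60_8]; decide

/-- Hall holds at `S60` from hub multiplicity 60 on … -/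
theorem hallAt_60 : HallAt (Dj 60) S60 := by
  unfold HallAt; rw [show massP (Dj 60) S60 = 60 from by decide +kernel, massN_S60_60]

/-- … but SURPLUS-EIGHT fails at `S60` for hub multiplicity 60 and 67 (so `𝓔` is not locally free for ANY maps, Fulton Ex. 14.4.13(b)) … -/
theorem not_surplusAt_60 : ¬ SurplusAt (Dj 60) S60 := by
  unfold SurplusAt; rw [show massP (Dj 60) S60 = 60 from by decide +kernel, massN_S60_60]; decide
theorem not_surplusAt_67 : ¬ SurplusAt (Dj 67) S60 := by
  unfold SurplusAt; rw [show massP (Dj 67) S60 = 60 from by decide +kernel, massN_S60_67]; decide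

/-- … and holds from 68 on (the in-budget window is `j ∈ [68, 71]`: copies `196 … 199`). -/
theorem surplusAt_68 : SurplusAt (Dj 68) S60 := by
  unfold SurplusAt; rw [show massP (Dj 68) S60 = 60 from by decide +kernel, massN_S60_68]
theorem surplusAt_71 : SurplusAt (Dj 71) S60 := by
  unfold SurplusAt; rw [show massP (Dj 71) S60 = 60 from by decide +kernel, massN_S60_71]; decide

/-- COVER-NINE table on B136: `false`, with exactly 60 failing entries (live N-mass 8 = dim X < m + 8 = 9). -/
theorem cover_table_8 : allB DP (fun xm => decide (xm.2 + 8 ≤ massAbove (Dj 8) xm.1)) = false := by decide +kernel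
theorem cover_failures_8 : (DP.filter fun xm => !(decide (xm.2 + 8 ≤ massAbove (Dj 8) xm.1))).length = 60 := by decide +kernel
theorem cover_table_68 : allB DP (fun xm => decide (xm.2 + 8 ≤ massAbove (Dj 68) xm.1)) = true := by decide +kernel

/-- **¬ COVER-NINE (B136).** -/
theorem not_coverNine_8 : ¬ CoverNine (Dj 8) := by
  intro h
  have hall : allB DP (fun xm => decide (xm.2 + 8 ≤ massAbove (Dj 8) xm.1)) = true := by
    rw [allB_iff]
    intro xm hx
    have hpos : 0 < xm.2 := by
      have hp := (allB_iff _ _).1 posP xm hx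
      simpa using hp
    exact decide_eq_true (h xm hx hpos)
  rw [cover_table_8] at hall
  exact Bool.false_ne_true hall

/-- **COVER-NINE (D_68).** -/
theorem coverNine_68 : CoverNine (Dj 68) := by
  intro xm hx _
  have h := (allB_iff _ _).1 cover_table_68 xm hx
  simpa using h

/-- The ladder on the family in one line: B136 fails HALL at `S60` and COVER; `D_60`, `D_67` pass HALL at `S60` but fail SURPLUS-EIGHT;
`D_68` (copies 196, rank 68) and `D_71` (copies 199, rank 71) pass all three at `S60`. -/
theorem ladder :
    ¬ HallAt (Dj 8) S60 ∧ ¬ CoverNine (Dj 8) ∧ HallAt (Dj 60) S60 ∧ ¬ SurplusAt (Dj 60) S60 ∧ ¬ SurplusAt (Dj 67) S60 ∧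
      SurplusAt (Dj 68) S60 ∧ CoverNine (Dj 68) ∧ (Dj 68).copies = 196 ∧ (Dj 68).rank = 68 ∧
      SurplusAt (Dj 71) S60 ∧ (Dj 71).copies = 199 ∧ (Dj 71).rank = 71 :=
  ⟨not_hallAt_8, not_coverNine_8, hallAt_60, not_surplusAt_60, not_surplusAt_67, surplusAt_68, coverNine_68, copies_68, rank_68,
    surplusAt_71, copies_71, rank_71⟩

end Summit.HodgeConjecture.HodgeConjecture.Cruxes.BlochSeedDiscOne.LFLadderB136
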